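import Summits.KontsevichZagierPeriods.KontsevichZagierPeriods.Theorems.SoloInformedToricDenCalculus
import HarnessLib

/-!
# RULE SPLIT: box splitting and affine rescaling inside the calculus

Solo programme `solo-KontsevichZagierPeriods-informed`, session s106 (DEN-calculus, 2).

The rules ND / VERTEX / DIAG of `SoloInformedToricDenCalculus` only see singularities of the
denominator at the VERTICES of the cube.  Here the fourth move of embedded resolution inside
`[0,1]ⁿ` is typed: cut the cube along a rational hyperplane `x_i = c` (`0 < c < 1`,
Kontsevich–Zagier rule (1a); the hyperplane is null) and rescale each half back to the unit
cube by the affine maps `Λ_{i,0,c} : x_i ↦ c·x_i` and `Λ_{i,c,1−c} : x_i ↦ c + (1−c)·x_i`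
(rule (2), constant Jacobians `c` and `1 − c`).

* `soloInformedScaleMove i a b` (`x_i ↦ a + b·x_i`), its derivative `soloInformedScaleDeriv`
  (`det = b`), semialgebraicity, injectivity, image `soloInformedSlab i a b =
  {x ∈ (0,1)ⁿ : a < x_i < a + b}` for `0 ≤ a`, `0 < b`, `a + b ≤ 1`;
* `soloInformedScaleSubst i a b = bind₁ (x_i ↦ C a + C b·x_i)` with
  `aeval x (scaleSubst P) = aeval (Λ x) P`;
* `soloInformed_volume_hyperplane`: `{x | x_i = c}` is null;
* **RULE SPLIT** `soloInformed_presentableDen_of_split`: if `Q ≠ 0` on `(0,1)ⁿ ∖ {x_i = c}` and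
  both rescaled halves `scaleSubst i 0 c Q`, `scaleSubst i c (1−c) Q` are presentable
  denominators, so is `Q` — zeros of `Q` ON the cutting hyperplane are allowed;
* RULE UNIT (`C u · Q`), RULE VERTEX′ (`soloInformed_presentableDen_of_eq_vertexMove`: a
  polynomial whose function is a vertex-moved presentable nowhere-vanishing one is presentable);
* Examples beyond every vertex rule (an EDGE point, the CENTRE of the square) follow in
  `SoloInformedToricBoxSplitExamples`.

References: M. Kontsevich, D. Zagier, *Periods* (2001) §1.2 rules (1a), (2); J. Ayoub, EMS
Newsl. 91 (2014) §2.2.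
-/

noncomputable section

open scoped BigOperators
open MeasureTheory Set
open Literature.NumberTheory.Transcendental Literature.NumberTheory.Transcendental.KZ
open Literature.ModelTheory.ExponentialFields (IsSemialgebraic)

namespace Summit.KontsevichZagierPeriods.KontsevichZagierPeriods.Theorems

variable {n : ℕ}

/-! ## The affine rescaling of one coordinate -/

/-- The scale move `Λ_{i,a,b}`: `x_i ↦ a + b·x_i`, the other coordinates fixed. -/
def soloInformedScaleMove (i : Fin n) (a b : ℚ) (x : Fin n → ℝ) : Fin n → ℝ :=
  fun j => if j = i then (a : ℝ) + (b : ℝ) * x j else x j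

/-- The moved coordinate. -/
theorem soloInformed_scaleMove_apply_self (i : Fin n) (a b : ℚ) (x : Fin n → ℝ) :
    soloInformedScaleMove i a b x i = a + b * x i := by
  simp [soloInformedScaleMove]

/-- The fixed coordinates. -/
theorem soloInformed_scaleMove_apply_ne (i : Fin n) (a b : ℚ) (x : Fin n → ℝ) {j : Fin n}
    (hj : j ≠ i) : soloInformedScaleMove i a b x j = x j := by
  simp [soloInformedScaleMove, hj]

/-- The scale move is injective for `b ≠ 0`. -/
theorem soloInformed_scaleMove_injective (i : Fin n) {a b : ℚ} (hb : b ≠ 0) :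
    Function.Injective (soloInformedScaleMove i a b) := fun x y h => by
  funext j
  have hj := congr_fun h j
  by_cases hji : j = i
  · subst hji
    rw [soloInformed_scaleMove_apply_self, soloInformed_scaleMove_apply_self] at hj
    have hb' : (b : ℝ) ≠ 0 := by exact_mod_cast hb
    exact mul_left_cancel₀ hb' (add_left_cancel hj)
  · rwa [soloInformed_scaleMove_apply_ne i a b x hji, soloInformed_scaleMove_apply_ne i a b y hji]
      at hj

/-- The (constant) derivative `diag(1, …, b, …, 1)` of the scale move. -/
def soloInformedScaleDeriv (i : Fin n) (b : ℚ) : (Fin n → ℝ) →L[ℝ] (Fin n → ℝ) :=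
  ContinuousLinearMap.pi fun j =>
    if j = i then (b : ℝ) • ContinuousLinearMap.proj (R := ℝ) (φ := fun _ : Fin n => ℝ) j
    else ContinuousLinearMap.proj (R := ℝ) (φ := fun _ : Fin n => ℝ) j

/-- Components of the derivative of the scale move. -/
theorem soloInformed_scaleDeriv_apply (i : Fin n) (b : ℚ) (v : Fin n → ℝ) (j : Fin n) :
    soloInformedScaleDeriv i b v j = if j = i then (b : ℝ) * v j else v j := by
  unfold soloInformedScaleDeriv
  rw [ContinuousLinearMap.pi_apply]
  by_cases hj : j = i <;> simp [hj]

/-- `det diag(1, …, b, …, 1) = b`. -/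
theorem soloInformed_det_scaleDeriv (i : Fin n) (b : ℚ) :
    (soloInformedScaleDeriv i b).det = b := by
  have hmat : ((soloInformedScaleDeriv i b : (Fin n → ℝ) →L[ℝ] (Fin n → ℝ)) :
      (Fin n → ℝ) →ₗ[ℝ] (Fin n → ℝ)) =
      Matrix.toLin' (Matrix.diagonal fun j : Fin n => if j = i then (b : ℝ) else 1) := by
    refine LinearMap.ext fun v => funext fun j => ?_
    rw [ContinuousLinearMap.coe_coe, soloInformed_scaleDeriv_apply, Matrix.toLin'_apply,
      Matrix.mulVec_diagonal]
    by_cases hj : j = i <;> simp [hj]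
  change LinearMap.det _ = _
  rw [hmat, LinearMap.det_toLin', Matrix.det_diagonal]
  simp

/-- The scale move has derivative `diag(1, …, b, …, 1)` everywhere. -/
theorem soloInformed_hasFDerivAt_scaleMove (i : Fin n) (a b : ℚ) (x : Fin n → ℝ) :
    HasFDerivAt (soloInformedScaleMove i a b) (soloInformedScaleDeriv i b) x := by
  unfold soloInformedScaleMove soloInformedScaleDeriv
  refine hasFDerivAt_pi.2 fun j => ?_
  by_cases hj : j = i
  · simp only [hj, if_true]
    exact ((hasFDerivAt_apply i x).const_mul (b : ℝ)).const_add (a : ℝ)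
  · simp only [hj, if_false]
    exact hasFDerivAt_apply j x

/-- The scale move is a `ℚ`-semialgebraic map on every `ℚ`-semialgebraic set. -/
theorem soloInformed_isSemialgebraicMapOn_scaleMove (i : Fin n) (a b : ℚ)
    {s : Set (Fin n → ℝ)} (hs : IsSemialgebraic ℚ s) :
    IsSemialgebraicMapOn ℚ s (soloInformedScaleMove i a b) :=
  (isSemialgebraicMapOn_aeval hs fun j =>
      (if j = i then MvPolynomial.C a + MvPolynomial.C b * MvPolynomial.X j else MvPolynomial.X j :
        MvPolynomial (Fin n) ℚ)).congr
    fun x _ => by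
      funext j
      by_cases hj : j = i <;> simp [soloInformedScaleMove, hj]

/-- The rescaled polynomial `P ↦ P(Λ_{i,a,b} x)` (an algebra endomorphism of `ℚ[x]`). -/
def soloInformedScaleSubst (i : Fin n) (a b : ℚ) :
    MvPolynomial (Fin n) ℚ →ₐ[ℚ] MvPolynomial (Fin n) ℚ :=
  MvPolynomial.bind₁ fun j =>
    if j = i then MvPolynomial.C a + MvPolynomial.C b * MvPolynomial.X j else MvPolynomial.X j

/-- Evaluating the rescaled polynomial is evaluating at the moved point. -/
theorem soloInformed_aeval_scaleSubst (i : Fin n) (a b : ℚ) (x : Fin n → ℝ)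
    (P : MvPolynomial (Fin n) ℚ) :
    MvPolynomial.aeval x (soloInformedScaleSubst i a b P) =
      MvPolynomial.aeval (soloInformedScaleMove i a b x) P := by
  unfold soloInformedScaleSubst
  rw [MvPolynomial.aeval_bind₁]
  have h : (fun j => MvPolynomial.aeval x
      (if j = i then MvPolynomial.C a + MvPolynomial.C b * MvPolynomial.X j else MvPolynomial.X j :
        MvPolynomial (Fin n) ℚ)) = soloInformedScaleMove i a b x := by
    funext j
    by_cases hj : j = i <;> simp [soloInformedScaleMove, hj]
  rw [h]

/-! ## Slabs: the images of the open cube -/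

/-- The slab `{x ∈ (0,1)ⁿ : a < x_i < a + b}`. -/
def soloInformedSlab (i : Fin n) (a b : ℚ) : Set (Fin n → ℝ) :=
  {x | x ∈ soloInformedOpenCube n ∧ (a : ℝ) < x i ∧ x i < a + b}

/-- Slabs lie in the open cube. -/
theorem soloInformedSlab_subset_openCube (i : Fin n) (a b : ℚ) :
    soloInformedSlab i a b ⊆ soloInformedOpenCube n := fun _ hx => hx.1

/-- Slabs are `ℚ`-semialgebraic. [BCR 1998, §2.1] -/
theorem isSemialgebraic_soloInformedSlab (i : Fin n) (a b : ℚ) :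
    IsSemialgebraic ℚ (soloInformedSlab i a b) := by
  have h1 : IsSemialgebraic ℚ {x : Fin n → ℝ | (a : ℝ) < x i} := by
    simpa using Literature.ModelTheory.ExponentialFields.isSemialgebraic_setOf_eval_lt (k := ℚ)
      (R := ℝ) (MvPolynomial.C a : MvPolynomial (Fin n) ℚ) (MvPolynomial.X i)
  have h2 : IsSemialgebraic ℚ {x : Fin n → ℝ | x i < a + b} := by
    simpa using Literature.ModelTheory.ExponentialFields.isSemialgebraic_setOf_eval_lt (k := ℚ)
      (R := ℝ) (MvPolynomial.X i : MvPolynomial (Fin n) ℚ) (MvPolynomial.C (a + b))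
  have hset : soloInformedSlab i a b =
      (soloInformedOpenCube n ∩ {x : Fin n → ℝ | (a : ℝ) < x i}) ∩ {x | x i < a + b} := by
    ext x
    simp only [soloInformedSlab, mem_setOf_eq, mem_inter_iff]
    tauto
  rw [hset]
  exact ((isSemialgebraic_soloInformedOpenCube n).inter h1).inter h2

/-- For `0 ≤ a`, `0 < b`, `a + b ≤ 1` the scale move maps the open cube into the slab. -/
theorem soloInformed_scaleMove_mem (i : Fin n) {a b : ℚ} (ha : 0 ≤ a) (hb : 0 < b)
    (hab : a + b ≤ 1) {x : Fin n → ℝ} (hx : x ∈ soloInformedOpenCube n) :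
    soloInformedScaleMove i a b x ∈ soloInformedSlab i a b := by
  have ha' : (0 : ℝ) ≤ a := by exact_mod_cast ha
  have hb' : (0 : ℝ) < b := by exact_mod_cast hb
  have hab' : (a : ℝ) + b ≤ 1 := by exact_mod_cast hab
  have h1 : (a : ℝ) < a + b * x i := lt_add_of_pos_right _ (mul_pos hb' (hx i).1)
  have h2 : (a : ℝ) + b * x i < a + b := by
    have := mul_lt_of_lt_one_right hb' (hx i).2
    linarith
  refine ⟨fun j => ?_, ?_, ?_⟩
  · by_cases hj : j = i
    · rw [hj, soloInformed_scaleMove_apply_self]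
      exact ⟨lt_of_le_of_lt ha' h1, lt_of_lt_of_le h2 hab'⟩
    · rw [soloInformed_scaleMove_apply_ne i a b x hj]
      exact hx j
  · rw [soloInformed_scaleMove_apply_self]; exact h1
  · rw [soloInformed_scaleMove_apply_self]; exact h2

/-- For `0 ≤ a`, `0 < b`, `a + b ≤ 1` the scale move maps the open cube ONTO the slab. -/
theorem soloInformed_image_scaleMove (i : Fin n) {a b : ℚ} (ha : 0 ≤ a) (hb : 0 < b)
    (hab : a + b ≤ 1) :
    soloInformedScaleMove i a b '' soloInformedOpenCube n = soloInformedSlab i a b := by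
  refine Subset.antisymm (image_subset_iff.2 fun x hx => soloInformed_scaleMove_mem i ha hb hab hx)
    fun x hx => ?_
  have hb' : (0 : ℝ) < b := by exact_mod_cast hb
  have hb0 : (b : ℝ) ≠ 0 := hb'.ne'
  refine ⟨fun j => if j = i then (x i - a) / b else x j, fun j => ?_, ?_⟩
  · by_cases hj : j = i
    · simp only [hj, if_true]
      exact ⟨div_pos (sub_pos.2 hx.2.1) hb', (div_lt_one hb').2 (by linarith [hx.2.2])⟩
    · simp only [hj, if_false]
      exact hx.1 j
  · funext j
    by_cases hj : j = i
    · rw [hj, soloInformed_scaleMove_apply_self]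
      simp only [if_true]
      field_simp
      ring
    · rw [soloInformed_scaleMove_apply_ne i a b _ hj]
      simp only [hj, if_false]

/-- Coordinate hyperplanes `{x | x_i = c}` are null. -/
theorem soloInformed_volume_hyperplane (i : Fin n) (c : ℝ) :
    volume {x : Fin n → ℝ | x i = c} = 0 := by
  have hsub : {x : Fin n → ℝ | x i = c} ⊆
      Set.pi univ (fun j => if j = i then ({c} : Set ℝ) else univ) := by
    intro x hx j _
    by_cases hj : j = i
    · rw [hj]; simpa using hx
    · simp [hj]
  refine measure_mono_null hsub ?_
  rw [volume_pi_pi]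
  exact Finset.prod_eq_zero (Finset.mem_univ i) (by simp)

/-! ## Transport along a scale move and RULE SPLIT -/

/-- **Rule (2) along a scale move.**  If `Q ≠ 0` on the slab and the rescaled denominator
`scaleSubst i a b Q` is presentable, then the restriction to the slab of every `IntegralRep`
on `(0,1)ⁿ` with integrand `P/Q` is presentable (pull back along `Λ_{i,a,b}`, Jacobian `b`:
the pulled-back form is `(C b · scaleSubst P)/(scaleSubst Q)` on `(0,1)ⁿ`). [this work] -/
theorem soloInformed_presentable_restrict_slab (i : Fin n) {a b : ℚ} (ha : 0 ≤ a) (hb : 0 < b)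
    (hab : a + b ≤ 1) (P Q : MvPolynomial (Fin n) ℚ)
    (hQ : ∀ x ∈ soloInformedSlab i a b, MvPolynomial.aeval x Q ≠ 0)
    (hS : SoloInformedPresentableDen (soloInformedScaleSubst i a b Q)) (ρ : IntegralRep n)
    (hρi : EqOn ρ.integrand (fun x => MvPolynomial.aeval x P / MvPolynomial.aeval x Q)
      (soloInformedOpenCube n))
    (hD : soloInformedSlab i a b ⊆ ρ.domain) :
    of (ρ.restrict (soloInformedSlab i a b) (isSemialgebraic_soloInformedSlab i a b) hD) ∈
      soloInformedPresentable := by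
  have hQt : ∀ x ∈ soloInformedOpenCube n,
      MvPolynomial.aeval x (soloInformedScaleSubst i a b Q) ≠ 0 := fun x hx => by
    rw [soloInformed_aeval_scaleSubst]
    exact hQ _ (soloInformed_scaleMove_mem i ha hb hab hx)
  have hmeas : MeasurableSet (soloInformedOpenCube n) := by
    rw [soloInformedOpenCube_eq_pi]; exact MeasurableSet.univ_pi fun _ => measurableSet_Ioo
  have hderiv : ∀ x ∈ soloInformedOpenCube n, HasFDerivWithinAt (soloInformedScaleMove i a b)
      (soloInformedScaleDeriv i b) (soloInformedOpenCube n) x :=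
    fun x _ => (soloInformed_hasFDerivAt_scaleMove i a b x).hasFDerivWithinAt
  have hinj : InjOn (soloInformedScaleMove i a b) (soloInformedOpenCube n) :=
    (soloInformed_scaleMove_injective i hb.ne').injOn
  have habs : |(soloInformedScaleDeriv i b).det| = b := by
    rw [soloInformed_det_scaleDeriv]; exact abs_of_pos (by exact_mod_cast hb)
  have hdom : (ρ.restrict (soloInformedSlab i a b) (isSemialgebraic_soloInformedSlab i a b)
      hD).domain = soloInformedScaleMove i a b '' soloInformedOpenCube n := by
    rw [soloInformed_image_scaleMove i ha hb hab]; rfl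
  have hform : ∀ x ∈ soloInformedOpenCube n,
      MvPolynomial.aeval x (MvPolynomial.C b * soloInformedScaleSubst i a b P) /
          MvPolynomial.aeval x (soloInformedScaleSubst i a b Q) =
        ρ.integrand (soloInformedScaleMove i a b x) * |(soloInformedScaleDeriv i b).det| :=
    fun x hx => by
      rw [habs, hρi (soloInformed_scaleMove_mem i ha hb hab hx).1, map_mul, MvPolynomial.aeval_C,
        soloInformed_aeval_scaleSubst, soloInformed_aeval_scaleSubst, eq_ratCast]
      ring
  have hint1 : IntegrableOn (fun x => |(soloInformedScaleDeriv i b).det| •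
      ρ.integrand (soloInformedScaleMove i a b x)) (soloInformedOpenCube n) := by
    have h := (ρ.restrict (soloInformedSlab i a b) (isSemialgebraic_soloInformedSlab i a b)
      hD).integrableOn
    rw [hdom, integrableOn_image_iff_integrableOn_abs_det_fderiv_smul volume hmeas hderiv hinj]
      at h
    exact h
  have hint' : IntegrableOn (fun x =>
      MvPolynomial.aeval x (MvPolynomial.C b * soloInformedScaleSubst i a b P) /
        MvPolynomial.aeval x (soloInformedScaleSubst i a b Q)) (soloInformedOpenCube n) :=
    hint1.congr_fun (fun x hx => by
      show |(soloInformedScaleDeriv i b).det| • ρ.integrand (soloInformedScaleMove i a b x) = _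
      rw [hform x hx, smul_eq_mul, mul_comm]) hmeas
  set ρt := IntegralRep.ofRational (soloInformedOpenCube n)
      (MvPolynomial.C b * soloInformedScaleSubst i a b P) (soloInformedScaleSubst i a b Q)
      (isSemialgebraic_soloInformedOpenCube n) hQt hint' with hρt
  have h2 : of ρt - of (ρ.restrict (soloInformedSlab i a b)
      (isSemialgebraic_soloInformedSlab i a b) hD) ∈ relations := by
    refine changeOfVariablesRel_subset_relations ⟨n, ρt, _, soloInformedScaleMove i a b,
      fun _ => soloInformedScaleDeriv i b,
      soloInformed_isSemialgebraicMapOn_scaleMove i a b (isSemialgebraic_soloInformedOpenCube n),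
      hderiv, hinj, hdom, fun x hx => ?_, rfl⟩
    have hx' : x ∈ soloInformedOpenCube n := hx
    show MvPolynomial.aeval x (MvPolynomial.C b * soloInformedScaleSubst i a b P) /
        MvPolynomial.aeval x (soloInformedScaleSubst i a b Q) = _
    exact hform x hx'
  have hpres : of ρt ∈ soloInformedPresentable :=
    hS (MvPolynomial.C b * soloInformedScaleSubst i a b P) ρt subset_rfl
      (soloInformedOpenCube_subset_cube n) fun _ _ => rfl
  rw [← neg_sub] at h2
  exact soloInformed_presentable_of_sub_mem (by simpa using relations.neg_mem h2) hpres

/-- **RULE SPLIT.**  Let `0 < c < 1` be rational and suppose `Q ≠ 0` on `(0,1)ⁿ` off the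
hyperplane `x_i = c`.  If both rescaled halves `Q(…, c·x_i, …)` and `Q(…, c + (1−c)·x_i, …)`
are presentable denominators, then so is `Q`: rule (1a) along `x_i = c` (a null hyperplane,
`∂(0,1)ⁿ` null) and rule (2) along the two scale moves. [this work] -/
theorem soloInformed_presentableDen_of_split (i : Fin n) (c : ℚ) (hc0 : 0 < c) (hc1 : c < 1)
    {Q : MvPolynomial (Fin n) ℚ}
    (hQ : ∀ x ∈ soloInformedOpenCube n, x i ≠ (c : ℝ) → MvPolynomial.aeval x Q ≠ 0)
    (h₁ : SoloInformedPresentableDen (soloInformedScaleSubst i 0 c Q))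
    (h₂ : SoloInformedPresentableDen (soloInformedScaleSubst i c (1 - c) Q)) :
    SoloInformedPresentableDen Q := by
  refine soloInformed_presentableDen_of_open Q fun P ρ hρ hρi => ?_
  have hD₁ : soloInformedSlab i 0 c ⊆ ρ.domain := by
    rw [hρ]; exact soloInformedSlab_subset_openCube i 0 c
  have hD₂ : soloInformedSlab i c (1 - c) ⊆ ρ.domain := by
    rw [hρ]; exact soloInformedSlab_subset_openCube i c (1 - c)
  have hQ₁ : ∀ x ∈ soloInformedSlab i 0 c, MvPolynomial.aeval x Q ≠ 0 := fun x hx =>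
    hQ x hx.1 (by have h := hx.2.2; push_cast at h; exact ne_of_lt (by linarith))
  have hQ₂ : ∀ x ∈ soloInformedSlab i c (1 - c), MvPolynomial.aeval x Q ≠ 0 := fun x hx =>
    hQ x hx.1 (ne_of_gt hx.2.1)
  refine soloInformed_presentable_of_cover ρ (isSemialgebraic_soloInformedSlab i 0 c)
    (isSemialgebraic_soloInformedSlab i c (1 - c)) hD₁ hD₂ ?_ ?_
    (soloInformed_presentable_restrict_slab i le_rfl hc0 (by linarith) P Q hQ₁ h₁ ρ hρi hD₁)
    (soloInformed_presentable_restrict_slab i hc0.le (by linarith) (by linarith) P Q hQ₂ h₂ ρ hρi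
      hD₂)
  · refine measure_mono_null (fun x hx => ?_) (measure_empty (μ := volume (α := Fin n → ℝ)))
    have h1 := hx.1.2.2
    have h2 := hx.2.2.1
    push_cast at h1
    exact absurd (h1.trans (by linarith)) (lt_irrefl (x i))
  · refine measure_mono_null (fun x hx => ?_) (soloInformed_volume_hyperplane i (c : ℝ))
    have hxO : x ∈ soloInformedOpenCube n := hρ ▸ hx.1
    by_contra hne
    rcases lt_or_gt_of_ne hne with hlt | hgt
    · exact hx.2 (Or.inl ⟨hxO, by push_cast; exact (hxO i).1, by push_cast; linarith⟩)
    · exact hx.2 (Or.inr ⟨hxO, hgt, by push_cast; linarith [(hxO i).2]⟩)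

/-! ## Two small rules -/

/-- RULE UNIT: scaling the denominator by a rational constant `u` (absorbed by the numerator
as `u⁻¹`; for `u = 0` both sides are the zero integrand, Lean's `x / 0 = 0`). [this work] -/
theorem soloInformed_presentableDen_C_mul {Q : MvPolynomial (Fin n) ℚ} (u : ℚ)
    (h : SoloInformedPresentableDen Q) : SoloInformedPresentableDen (MvPolynomial.C u * Q) := by
  intro P r hO hC hri
  refine h (MvPolynomial.C u⁻¹ * P) r hO hC fun x hx => ?_
  rw [hri hx]
  show MvPolynomial.aeval x P / MvPolynomial.aeval x (MvPolynomial.C u * Q) =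
    MvPolynomial.aeval x (MvPolynomial.C u⁻¹ * P) / MvPolynomial.aeval x Q
  simp only [map_mul, MvPolynomial.aeval_C, eq_ratCast, Rat.cast_inv]
  ring

/-- RULE VERTEX′: a polynomial `T` whose function on `(0,1)ⁿ` is `x ↦ B(Φ_S x)` for a
presentable denominator `B` non-vanishing on `(0,1)ⁿ` is a presentable denominator.
[this work] -/
theorem soloInformed_presentableDen_of_eq_vertexMove (S : Finset (Fin n))
    {B T : MvPolynomial (Fin n) ℚ} (hB : SoloInformedPresentableDen B)
    (hB0 : ∀ x ∈ soloInformedOpenCube n, MvPolynomial.aeval x B ≠ 0)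
    (hT : ∀ x ∈ soloInformedOpenCube n,
      MvPolynomial.aeval x T = MvPolynomial.aeval (soloInformedVertexMove S x) B) :
    SoloInformedPresentableDen T := by
  refine soloInformed_presentableDen_of_vertexReflect S (fun x hx => ?_)
    (soloInformed_presentableDen_congr (fun x hx => ?_) hB)
  · rw [hT x hx]; exact hB0 _ (soloInformed_vertexMove_mem S hx)
  · rw [soloInformed_aeval_vertexReflect, hT _ (soloInformed_vertexMove_mem S hx),
      soloInformed_vertexMove_vertexMove]

end Summit.KontsevichZagierPeriods.KontsevichZagierPeriods.Theorems
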